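import Literature.NumberTheory.EllipticCurves.CastellaGrossiLeeSkinner2022.IMC2DivisibilityAndBDPValueFrame
import Literature.NumberTheory.EllipticCurves.CastellaGrossiSkinner2025.HeegnerPointMainConjecture
import HarnessLib

/-!
# Yan–Zhu 2026 (J. Algebra 693 = arXiv:2412.20078v4), §5.2 "Anticyclotomic main conjectures":
# Theorem 5.7 (= arXiv v2 Thm. 4.12) AS PRINTED IN THE JOURNAL VERSION — (1) the BDP main
# conjecture for `𝒳_{𝓕_Gr}(E/K_∞⁻)` (rational equality; INTEGRAL equality under full image of
# `ρ_E|_{G_K}`), (2) the Heegner point main conjecture (rational equality; integral under full image)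
# — at an odd good ORDINARY prime with `ρ̄_E|_{G_K}` irreducible, `(E, K)` Heegner, any conductor

Source: Xiaojun Yan, Xiuwu Zhu, *Main conjectures for non-CM elliptic curves at good ordinary
primes*, J. Algebra **693** (2026) 372–402, doi:10.1016/j.jalgebra.2026.01.016 = arXiv:2412.20078.
Locators are those of arXiv **v4** (2026-01-23, the revision carrying the journal DOI; TeX `main.tex`,
e-print held at `run/shared/lean/b2b/bsd-rank1-residual/b2b-bsdres-lit/g98/eprints/yz_v4/`, numbering
table `g98_yz_v4.numbers.txt`): §5.2 l.1187–1312 — setting l.1189–1190, Conj. 5.5 (BDP main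
conjecture) l.1192–1197, `S_ord(E/K_∞⁻)` l.1199–1203, Perrin-Riou's `κ` l.1205–1207, Conj. 5.6
(Heegner point main conjecture) l.1209–1215, **Theorem 5.7** (`\label{ac}`) l.1217–1242, Thm. 5.8
l.1248–1263 (= [CGS, Thm. 6.5.2] + [How, Thm. B]), Thm. 5.9 l.1283–1293, proof l.1295–1308, Remark
5.10 l.1310–1312. Concordance with the store text `paper:arxiv-2412.20078` (= arXiv v2): Thm. 5.7 =
v2 Thm. 4.12 (§4.5), Thm. 5.8 = v2 Thm. 4.13, Thm. 5.9 = v2 Thm. 4.14 — WITH A CHANGE OF CONTENT in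
the integral clauses (below). Bib key `YanZhu2024MainConjNonCM`. Cell `pub/bsd-littype` (cross-ladder
literature-typing layer, D-0088(4)), seat `bsd-littype-04`.

## Why this file exists (the v2 → v4 drift of the integral clauses, located)

`YanZhu2026/BDPMainConjectureAtTrivialCharacter.lean` transcribed v2's Thm. 4.12 (1) (composed with
CGLS Thm. 5.1.3, at the trivial character) whose integral clause read "Moreover, if (Im) holds, then
`Char_{Λ_K}(𝒳(E/K_∞))Λ_K^ur = (𝓛_p^BDP(E/K))`". The refereed text prints instead (Thm. 5.7, l.1224
and l.1236, verbatim): "Moreover, if the representation `ρ_E|_{G_K} : G_K → Aut_{ℤ_p}(T_pE)` is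
surjective, then …", relegating (Im) to Remark 5.10 (l.1310–1312): "Via [BSTW, Proposition 12.7], the
condition in Theorem 5.7 that `ρ_E|_{G_K}` has full image can be weakened to condition (Im)." —
[BSTW] = Burungale–Skinner–Tian–Wan arXiv:2409.01350, a PREPRINT (lit GEN 98 finding; cell GLUE gen 12
re-sourced the rank-one `p`-part input through Cor. 5.4 instead,
`YanZhu2026/CyclotomicBDPCorollaryAtTrivialCharacter.lean`). THIS FILE vendors Theorem 5.7 ITSELF, both
parts, with the integral clauses under the hypothesis the journal prints (full image of `ρ_E|_{G_K}`),
as main-conjecture-level statements (identities of characteristic ideals), not as their trivial-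
character composites. The Remark 5.10 form (integral clauses under (Im)) is NOT vendored: its only
printed proof pointer is the preprint [BSTW, Prop. 12.7] (grade PREPRINT; referee target).

## The printed statements (v4, verbatim)

Setting (§5.2, l.1189–1190): "Let `E/ℚ` be an elliptic curve of conductor `N`, let `p > 2` be a prime
such that `E` has good ordinary reduction at `p`, and let `K` be an imaginary quadratic field such
that `p𝒪_K = 𝔭𝔭̄` splits in `K` and the pair `(E, K)` satisfies the Heegner hypothesis. Assume that the
residual representation `ρ̄_E|_{G_K} : G_K → Aut(E[p])` is irreducible." (`𝔭` is "the prime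
determined by the embedding `ι_p`", §1 l.292; `𝒳_{𝓕_Gr}(E/K_∞⁻) = H¹_{𝓕_Gr}(K, T_pE ⊗ Λ_K^{−,∨})^∨`
with `𝓕_Gr = 𝓕_{rel,str}`: relaxed at `𝔭`, strict at `𝔭̄`, Def. 2.1; `𝓛_p^BDP(E/K) := 𝓛_p^BDP(f/K) ∈
Λ_K^{ur,−}` for the newform `f` of `E`, Thm. 3.13 — "characterized by the interpolation property" at
anticyclotomic Hecke characters of infinity type `(n, −n)`, `n > 0`, `n ≡ 0 mod p − 1`, under §3.5's
standing "Assume that `D_K` is odd and not equal to `−3`, and that the Heegner hypothesis holds"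
(l.882); "See [CGLS, Theorem 2.1.1] for this refined construction" (l.893).)

"**Conjecture 5.5** (BDP main conjecture). `𝒳_{𝓕_Gr}(E/K_∞⁻)` is `Λ_K⁻`-torsion and
`Char_{Λ_K⁻}(𝒳_{𝓕_Gr}(E/K_∞⁻))Λ_K^{ur,−} = (𝓛_p^BDP(E/K))`."

"We define the compact Selmer group `S_ord(E/K_∞⁻) = lim←_n lim←_m Sel_{p^m}(E/K_n⁻)`, where `K_n⁻` is
the subfield of `K_∞⁻` with `[K_n⁻ : K] = p^n` … Fix a modular parametrization `π : X₀(N) → E`. In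
[PR], Perrin-Riou constructed an element `κ ∈ S_ord(E/K_∞⁻)` using the Kummer images of Heegner points
on `X₀(N)`, which is non-torsion over `Λ_K⁻` by a result of Cornut–Vatsal [CV]."

"**Conjecture 5.6** (Heegner point main conjecture). The modules `S_ord(E/K_∞⁻)` and
`𝒳_{𝓕_ord}(E/K_∞⁻)` are both of `Λ_K⁻`-rank one, and `Char_{Λ_K⁻}(𝒳_{𝓕_ord}(E/K_∞⁻)_tor) =
Char_{Λ_K⁻}(S_ord(E/K_∞⁻)/Λ_K⁻·κ)²`."

"**Theorem 5.7.** (1) `𝒳_{𝓕_Gr}(E/K_∞⁻)` is `Λ_K⁻`-torsion and `Char_{Λ_K⁻}(𝒳_{𝓕_Gr}(E/K_∞⁻))Λ_K^{ur,−}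
⊗ ℚ_p = (𝓛_p^BDP(E/K))` holds in `Λ_K^{ur,−} ⊗ ℚ_p`. Moreover, if the representation `ρ_E|_{G_K} : G_K
→ Aut_{ℤ_p}(T_pE)` is surjective, then `Char_{Λ_K⁻}(𝒳_{𝓕_Gr}(E/K_∞⁻))Λ_K^{ur,−} = (𝓛_p^BDP(E/K))`.
(2) The modules `S_ord(E/K_∞⁻)` and `𝒳_{𝓕_ord}(E/K_∞⁻)` are both of `Λ_K⁻`-rank one, and
`Char_{Λ_K⁻}(𝒳_{𝓕_ord}(E/K_∞⁻)_tor) ⊗ ℚ_p = Char_{Λ_K⁻}(S_ord(E/K_∞⁻)/Λ_K⁻·κ)² ⊗ ℚ_p` holds in `Λ_K⁻ ⊗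
ℚ_p`. Moreover, if the representation `ρ_E|_{G_K} : G_K → Aut_{ℤ_p}(T_pE)` is surjective, then
`Char_{Λ_K⁻}(𝒳_{𝓕_ord}(E/K_∞⁻)_tor) = Char_{Λ_K⁻}(S_ord(E/K_∞⁻)/Λ_K⁻·κ)²`."

Printed proof (l.1244–1308): Thm. 5.8 ([CGS, Thm. 6.5.2]: rational `⊇` in (2) under `E(K)[p] = 0`;
[How, Thm. B]: integral `⊇` under full image), Thm. 5.9 ("Arguing as in [BCK, Theorem 5.2]": for every
nontrivial multiplicative set `S ⊂ Λ_K⁻`, `S⁻¹`-BDP-divisibility ⇔ `S⁻¹`-HP-divisibility, both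
directions), `𝓛_p^BDP(E/K) ≠ 0` ([BCK, Cor. 4.5]), §4.3 (Thm. 4.2 = the two-variable main theorem,
Thm. 4.7, Cor. 4.6, Hsieh's `μ = 0`), Lemma 2.6 (`bdp_des`), [SU14, Cor. 3.8].

## Transcription (tree vocabulary only; binder for binder the currency of the sibling facts)

Part (1) is typed in the ∃-frame currency of `CastellaGrossiLeeSkinner2022.
proofThm422_exists_isBDPLFunction_isTorsion_charIdeal_dvd` (same module `𝔛_E = 𝒳_{𝓕_Gr}(E/K_∞⁻)`, same
`𝓛`): `W` a globally minimal model of `E`, `f` its newform (`IsNewformOf W f`) of level `N`; "`p > 2`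
good ordinary" = `3 ≤ p ∧ GoodOrd W p`; `K` imaginary quadratic (`IsImaginaryQuadratic K`), (Heeg)
`SatisfiesHeegnerHypothesis N K` (every `ℓ ∣ N` splits), (spl) `#{primes of 𝒪_K over p} = 2`, §3.5's
`Odd (discr K) ∧ discr K ≠ −3`; `ρ̄_E|_{G_K}` irreducible = `(W.baseChange K).HasIrreducibleModPGaloisRep
p`; `𝔭 = v` the prime of the embedding datum `ι' : ℚ̄_p ≃ ℂ` (compatibility clause verbatim as in the
sibling), `𝔭̄ = vbar ∋ p`, `vbar ≠ v`; `κ` THE anticyclotomic `ℤ_p`-extension with topological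
generator `γ` (`1 + T ↔ γ`, `Λ_K⁻ = IwasawaAlgebra p = ℤ_p⟦T⟧`); `𝒳_{𝓕_Gr}(E/K_∞⁻) = AcSelmer.XAc
(W.baseChange K) p κ vbar ∅ γ` (strict at `v̄`, relaxed at `v`; Castella 2018 Def. 2.2 / CGLS §2.3) with
characteristic ideal `AcSelmer.XAc.charIdeal …`; `𝓛_p^BDP(E/K)`: a frame `(Ω_K ≠ 0, Ω_p ∈ R₀ˣ, L ∈
R₀⟦T⟧)` with `IsBDPLFunction ι' v κ γ f Ω_K Ω_p L` (`R₀ = unrIntegers p = 𝒪_{ℚ_p^ur}^∧`, `Λ_K^{ur,−} =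
R₀⟦T⟧ = UnrSeries p`; CGLS Thm. 2.1.1 vs Castella 2018 Thm. 3.1 normalisations differ by a unit of
`R₀⟦T⟧`, immaterial for ideal statements — see the sibling's module docstring and the tree theorem
`X11b.R1.span_singleton_eq_of_isBDPLFunction`); "`… Λ_K^{ur,−}`" = extension of ideals along THE
structure map `j : ℤ_p → R₀` (a universally quantified binder with its characterisation `j(x) = x` in
`ℂ_p`, as in the sibling); "`= (𝓛)` in `Λ_K^{ur,−} ⊗ ℚ_p`" = the two inclusions up to a power of `p`
(`∃ k, p^k·L ∈ char·R₀⟦T⟧` and `∃ k, p^k·char·R₀⟦T⟧ ⊆ (L)`; `R₀⟦T⟧` is Noetherian and `p` is a non-zero-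
divisor, so this IS equality of the extended ideals in `R₀⟦T⟧[1/p]`); "`ρ_E|_{G_K} : G_K →
Aut_{ℤ_p}(T_pE)` surjective" = every `ℤ_p`-linear automorphism of `(W.baseChange K).tateModule p` is a
`galoisRepTate (W.baseChange K) p σ` (the field `surjective` of the tree's `HowardHypotheses`,
verbatim); integral clause = literal equality of ideals of `R₀⟦T⟧`.

Part (2) is typed in the currency of `CastellaGrossiSkinner2025.thmC_charIdeal_torsion_eq_
heegnerCharIdeal_sq` (CGS 2025 Thm. C, the Eisenstein twin) and `Howard2004_thmB`: `S_ord(E/K_∞⁻) =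
D.S` for a `Λ`-adic Selmer datum `D : (W.baseChange K).LambdaAdicSelmerData κ γ` (`lim← lim←
Sel_{p^m}(E/K_n⁻)`), `𝒳_{𝓕_ord}(E/K_∞⁻) = X.X` for `X : (W.baseChange K).SelmerDualData κ γ`
(`Sel_{p^∞}(E/K_∞⁻)^∨`; at a good ordinary `p` split in `K` the ordinary `Λ`-adic condition of Def. 2.1
is the `p^∞`-Selmer condition over `K_∞⁻`, Remark 2.3 / Lemma 2.2 of the source and Greenberg 1999),
`Λ_K⁻·κ` = Howard's Heegner module `𝐇 = heegnerModule D F` for a Heegner family `F : HeegnerFamily N W K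
κ jbar` at level `N = N_E` (the tree's transcription of "Kummer images of Heegner points on `X₀(N)`",
norm-compatible up the anticyclotomic tower; `𝐇 = Λκ̃₁` by Howard 2004 Thm. 3.3.7 under the tree
vocabulary's standing `p ∤ h_K` — an EXTRA hypothesis here exactly as in the CGS 2025 twin, special
case, `-- TODO(general form)`), so `Char(S_ord/Λκ) = heegnerCharIdeal D F`; `Char(𝒳_tor) =
Module.charIdeal Λ (Submodule.torsion Λ X.X)`; rank one = `Module.Finite ∧ Module.finrank = 1`;
"`⊗ ℚ_p` equality" = the two inclusions up to a power of `p` in `Λ`; integral clause = literal equality.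

Status: REFEREED and published; the proof of part (1)/(2) runs through §4.3 (Thm. 4.7, "essentially
[BSTW, Proposition 9.18]", a preprint; "See also [BCS, Prop. 4.1.3] and [CGS, Prop. 4.2.1]") — cell
documentation flag `YZ26@3-BF-ERL-Ohta` (wording in `YanZhu2026/PPartBSD.lean`) on that proof-level
input at `p = 3`; [CGS] = Castella–Grossi–Skinner, Math. Ann. 393 (2025) (published); [How] = Howard,
Compos. Math. 140 (2004) (published; its standing hypotheses include `p ∤ h_K`, cf. the EXTRA binder);
[BCK] = Burungale–Castella–Kim, Algebra Number Theory 15 (2021) (published, printed for `p > 3`: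
"Arguing as in [BCK, Theorem 5.2]"). Nothing is asserted (D-0014): two named facts, no `_holds`.

## Contents
* `thm57_isTorsion_charIdealXGr_eq_bdpLFunction` — Thm. 5.7 (1) (named fact).
* `Thm57Hypotheses`, `thm57_rankOne_charIdealTorsion_eq_heegnerCharIdeal_sq` — Thm. 5.7 (2) (named fact).
* `charIdeal_torsion_dvd_and_dvd_of_thm57`, `Thm57Hypotheses.p_ne_two` — proved unfoldings.
(The source's names for statements 5.5 / 5.6 — printed above — are elided from the declaration
docstrings only because of the tree's docstring lint; the vendored objects are the THEOREMS 5.7 (1)/(2).)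

## References

* X. Yan, X. Zhu, J. Algebra 693 (2026) 372–402 = arXiv:2412.20078v4, §5.2 l.1187–1312 (Thm. 5.7
  l.1217–1242; Thm. 5.8 l.1248–1281; Thm. 5.9 l.1283–1293; Rem. 5.10 l.1310–1312); §3.5 l.880–903
  (Thm. 3.13, Prop. 3.14); Def. 2.1 l.473–499. = arXiv v2 §4.5 (Thm. 4.12–4.14), §3.5 (Thm. 3.12).
* F. Castella, G. Grossi, J. Lee, C. Skinner, Invent. Math. 227 (2022), Thm. 2.1.1 (`𝓛_E`), §2.3.
* F. Castella, G. Grossi, C. Skinner, Math. Ann. 393 (2025), Thm. 6.5.2 (= arXiv v1 Thm. 5.5.2).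
* B. Howard, Compos. Math. 140 (2004), Thm. B; A. Burungale, F. Castella, C.-H. Kim, ANT 15 (2021),
  Thm. 5.2, Cor. 4.5; B. Perrin-Riou, Bull. SMF 115 (1987).
-/

set_option autoImplicit false

noncomputable section

open scoped Classical

open PowerSeries WeierstrassCurve NumberField IsDedekindDomain Field
  Literature.NumberTheory.EllipticCurves Literature.NumberTheory.EllipticCurves.ModularForms
  Literature.NumberTheory.QuadraticFields Literature.NumberTheory.EllipticCurves.Rank1Residual
  Literature.NumberTheory.EllipticCurves.Castella2018

universe u

namespace Literature.NumberTheory.EllipticCurves.YanZhu2026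

/-- **Yan–Zhu, J. Algebra 693 (2026), Theorem 5.7 (1) (arXiv v4 l.1217–1227; = v2 Thm. 4.12 (1) with
the integral clause as printed in the journal) — the (BDP) statement 5.5 of the source for
`𝒳_{𝓕_Gr}(E/K_∞⁻)`, PROVED at an odd good ordinary prime with `ρ̄_E|_{G_K}` irreducible** (the source's
name for statement 5.5 is spelled out in the module docstring and elided here only because of the
tree's docstring lint; what is vendored is the THEOREM). Verbatim: "(1) `𝒳_{𝓕_Gr}(E/K_∞⁻)` is
`Λ_K⁻`-torsion and `Char_{Λ_K⁻}(𝒳_{𝓕_Gr}(E/K_∞⁻))Λ_K^{ur,−} ⊗ ℚ_p = (𝓛_p^BDP(E/K))` holds in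
`Λ_K^{ur,−} ⊗ ℚ_p`. Moreover, if the representation `ρ_E|_{G_K} : G_K → Aut_{ℤ_p}(T_pE)` is surjective,
then `Char_{Λ_K⁻}(𝒳_{𝓕_Gr}(E/K_∞⁻))Λ_K^{ur,−} = (𝓛_p^BDP(E/K))`", under the setting of §5.2 (l.1189–1190:
`E/ℚ` of conductor `N`; `p > 2` good ordinary; `K` imaginary quadratic, `p = 𝔭𝔭̄` split, `(E, K)`
Heegner; `ρ̄_E|_{G_K}` irreducible) and §3.5 (l.882: `D_K` odd, `D_K ≠ −3`, where `𝓛_p^BDP` lives).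
Transcription (module docstring): binders and currency of
`CastellaGrossiLeeSkinner2022.proofThm422_exists_isBDPLFunction_isTorsion_charIdeal_dvd` with the
paper's hypotheses — `3 ≤ p`, `GoodOrd W p`, `(W.baseChange K).HasIrreducibleModPGaloisRep p` — in
place of CGLS's Eisenstein ones; conclusion: a frame `(Ω_K, Ω_p, L)` of `𝓛_p^BDP(E/K)`
(`IsBDPLFunction`) such that `𝒳 = AcSelmer.XAc (W.baseChange K) p κ vbar ∅ γ` is `Λ`-torsion and, along
THE structure map `j : ℤ_p → R₀`, (rational) `p^k · L ∈ char(𝒳)·R₀⟦T⟧` and `p^{k'} · char(𝒳)·R₀⟦T⟧ ⊆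
(L)` for some `k, k'`, and (integral) if every `ℤ_p`-automorphism of `T_p E` is a `ρ_E(σ)`, `σ ∈ G_K`,
then `char(𝒳)·R₀⟦T⟧ = (L)`. The (Im)-form of the integral clause (Remark 5.10, via the preprint
[BSTW, Prop. 12.7]) is deliberately NOT part of this fact.
[cite: YanZhu2024MainConjNonCM, Thm. 5.7 (1) (§5.2, arXiv:2412.20078v4 TeX l.1217–1227) with setting l.1189–1190, statement 5.5 l.1192–1197, Thm. 3.13 / §3.5 l.880–893; = arXiv v2 Thm. 4.12 (1)]
[cite: CastellaGrossiLeeSkinner2022, Thm. 2.1.1 (the construction of `𝓛_p^BDP`, "See [CGLS, Theorem 2.1.1]")] -/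
def thm57_isTorsion_charIdealXGr_eq_bdpLFunction : Prop :=
  ∀ {p : ℕ} [Fact p.Prime] (ι' : PadicAlgCl p ≃+* ℂ) (W : WeierstrassCurve ℚ) [W.IsElliptic]
    [W.IsGloballyMinimal] (K : Type) [Field K] [NumberField K] (v vbar : HeightOneSpectrum (𝓞 K))
    (κ : ZpExtension K p) (γ : absoluteGaloisGroup K) [Fact (κ.IsTopGenerator γ)] {N : ℕ} [NeZero N]
    {f : CuspForm (CongruenceSubgroup.Gamma0 N) 2} (_ : IsNewformOf W f),
    3 ≤ p → GoodOrd W p → (W.baseChange K).HasIrreducibleModPGaloisRep p →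
    IsImaginaryQuadratic K → SatisfiesHeegnerHypothesis N K →
      ((Ideal.span {(p : ℤ)}).primesOver (𝓞 K)).ncard = 2 →
      Odd (NumberField.discr K) → NumberField.discr K ≠ -3 →
    (∀ (w : InfinitePlace K) (k : 𝓞 K), k ∈ v.asIdeal ↔ ‖ι'.symm (w.embedding (k : K))‖ < 1) →
      ((p : ℕ) : 𝓞 K) ∈ vbar.asIdeal → vbar ≠ v →
    κ.IsAnticyclotomic →
    ∃ (ΩK : ℂ) (Ωp : (unrIntegers p)ˣ) (L : UnrSeries p),
      ΩK ≠ 0 ∧ IsBDPLFunction ι' v κ γ f ΩK ((Ωp : unrIntegers p) : ℂ_[p]) L ∧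
      Module.IsTorsion (IwasawaAlgebra p) (AcSelmer.XAc (W.baseChange K) p κ vbar ∅ γ) ∧
      ∀ (j : ℤ_[p] →+* unrIntegers p),
        (∀ x : ℤ_[p], ((j x : unrIntegers p) : ℂ_[p]) = algebraMap ℚ_[p] ℂ_[p] (x : ℚ_[p])) →
        ((∃ k : ℕ, C ((p : unrIntegers p) ^ k) * L ∈
            (AcSelmer.XAc.charIdeal (W.baseChange K) p κ vbar ∅ γ).map (PowerSeries.map j)) ∧
          (∃ k : ℕ, ∀ G ∈ (AcSelmer.XAc.charIdeal (W.baseChange K) p κ vbar ∅ γ).map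
              (PowerSeries.map j), C ((p : unrIntegers p) ^ k) * G ∈ Ideal.span {L})) ∧
        ((∀ u : Module.End ℤ_[p] ((W.baseChange K).tateModule p), IsUnit u →
            u ∈ Set.range (galoisRepTate (W.baseChange K) p)) →
          (AcSelmer.XAc.charIdeal (W.baseChange K) p κ vbar ∅ γ).map (PowerSeries.map j) =
            Ideal.span {L})

section HeegnerPoint

variable (N : ℕ) [NeZero N] (W : WeierstrassCurve ℚ) [W.IsGloballyMinimal] (K : Type u) [Field K]
  [NumberField K] (p : ℕ) [Fact p.Prime] (κ : ZpExtension K p) (γ : Field.absoluteGaloisGroup K)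
  (jbar : AlgebraicClosure K →+* ℂ)

/-- **The setting of Yan–Zhu §5.2 for part (2) of Theorem 5.7** (arXiv v4 l.1189–1190), in the tree's
vocabulary, field for field the shape of `CastellaGrossiSkinner2025.ThmCHypotheses` (the Eisenstein
twin) with the paper's hypotheses: `E/ℚ` elliptic of conductor `N` (the level of the Heegner family /
of the parametrisation `π : X₀(N) → E`); "`p > 2` … good ordinary reduction at `p`" (`3 ≤ p`,
`GoodOrd W p`); "`ρ̄_E|_{G_K} : G_K → Aut(E[p])` is irreducible" (`HasIrreducibleModPGaloisRep` of the
base change); `K` imaginary quadratic with "(E, K) satisfies the Heegner hypothesis" (every `ℓ ∣ N`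
splits in `K`) and "`p𝒪_K = 𝔭𝔭̄` splits"; §3.5's standing "`D_K` is odd and not equal to `−3`" (l.882,
where the BDP `p`-adic `L`-function of the proof lives); `κ` the anticyclotomic `ℤ_p`-extension with
topological generator `γ`; and the EXTRA standing hypothesis `p ∤ h_K` of the tree's Heegner-family
vocabulary (Howard 2004 §3.3 / Thm. 3.3.7; NOT printed by Yan–Zhu — special case, see the TODO).
[cite: YanZhu2024MainConjNonCM, §5.2 setting (arXiv v4 l.1189–1190) and §3.5 (l.882)] -/
structure Thm57Hypotheses : Prop where
  /-- `E` is an elliptic curve. -/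
  isElliptic : W.IsElliptic
  /-- `N` is the conductor of `E`. -/
  level : N = W.conductorNorm ℤ
  /-- `p > 2`. -/
  three_le : 3 ≤ p
  /-- `p` is a prime of good ordinary reduction. -/
  goodOrd : GoodOrd W p
  /-- `ρ̄_E|_{G_K}` is irreducible. -/
  irreducible : (W.baseChange K).HasIrreducibleModPGaloisRep p
  /-- `K` is imaginary quadratic. -/
  isImaginaryQuadratic : IsImaginaryQuadratic K
  /-- (Heeg): every prime dividing `N` splits in `K`. -/
  heegner : SatisfiesHeegnerHypothesis N K
  /-- `D_K` is odd (§3.5). -/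
  discr_odd : Odd (discr K)
  /-- `D_K ≠ -3` (§3.5). -/
  discr_ne : discr K ≠ -3
  /-- `p𝒪_K = 𝔭𝔭̄` splits in `K`. -/
  split : ((Ideal.span {(p : ℤ)}).primesOver (𝓞 K)).ncard = 2
  /-- EXTRA (special case, Howard 2004 Thm. 3.3.7 / tree Heegner families): `p ∤ h_K`. -/
  not_dvd_classNumber : ¬ p ∣ classNumber K
  /-- `κ` is the anticyclotomic `ℤ_p`-extension of `K`. -/
  anticyclotomic : κ.IsAnticyclotomic
  /-- `γ` is a topological generator of `Gal(K_∞⁻/K)`. -/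
  topGenerator : κ.IsTopGenerator γ

-- TODO(general form): Yan–Zhu Thm. 5.7 (2) allows `p ∣ h_K`; the field `not_dvd_classNumber` is the
-- tree vocabulary's (Howard 2004 §3.3) standing hypothesis under which `heegnerModule D F = Λκ`
-- (Howard Thm. 3.3.7), exactly as in `CastellaGrossiSkinner2025.ThmCHypotheses`.

/-- **Yan–Zhu, J. Algebra 693 (2026), Theorem 5.7 (2) (arXiv v4 l.1229–1241; = v2 Thm. 4.12 (2) with
the integral clause as printed in the journal) — Perrin-Riou's (HPMC) statement 5.6 of the source,
PROVED at an odd good ordinary prime with `ρ̄_E|_{G_K}` irreducible** (the source's name for statement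
5.6 is spelled out in the module docstring and elided here only because of the tree's docstring lint;
what is vendored is the THEOREM). Verbatim: "(2) The modules `S_ord(E/K_∞⁻)` and
`𝒳_{𝓕_ord}(E/K_∞⁻)` are both of `Λ_K⁻`-rank one, and `Char_{Λ_K⁻}(𝒳_{𝓕_ord}(E/K_∞⁻)_tor) ⊗ ℚ_p =
Char_{Λ_K⁻}(S_ord(E/K_∞⁻)/Λ_K⁻·κ)² ⊗ ℚ_p` holds in `Λ_K⁻ ⊗ ℚ_p`. Moreover, if the representation
`ρ_E|_{G_K} : G_K → Aut_{ℤ_p}(T_pE)` is surjective, then `Char_{Λ_K⁻}(𝒳_{𝓕_ord}(E/K_∞⁻)_tor) =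
Char_{Λ_K⁻}(S_ord(E/K_∞⁻)/Λ_K⁻·κ)²`" — `S_ord(E/K_∞⁻) = lim←_n lim←_m Sel_{p^m}(E/K_n⁻)` (l.1199–1203),
`κ` Perrin-Riou's `Λ_K⁻`-adic Heegner class from a fixed parametrisation `π : X₀(N) → E` (l.1205–1207).
Transcription (module docstring; currency of `CastellaGrossiSkinner2025.thmC_charIdeal_torsion_eq_
heegnerCharIdeal_sq` and `Howard2004_thmB`): under `Thm57Hypotheses` (the printed setting plus the
EXTRA `p ∤ h_K`), for every `Λ`-adic Selmer datum `D` (`S_ord = D.S`), Heegner family `F` at level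
`N = N_E` (`Λκ = heegnerModule D F`, `Char(S_ord/Λκ) = heegnerCharIdeal D F`) and dual datum `X`
(`𝒳_{𝓕_ord}(E/K_∞⁻) = X.X`): `D.S` and `X.X` are finitely generated of `Λ`-rank one; (rational) the
ideals `I = char_Λ((X.X)_tors)` and `J = (heegnerCharIdeal D F)²` satisfy `p^k I ⊆ J` and `p^{k'} J ⊆
I` for some `k, k'` (equality in `Λ ⊗ ℚ_p`); (integral) if every `ℤ_p`-automorphism of `T_p E` is a
`ρ_E(σ)`, `σ ∈ G_K`, then `I = J`. The (Im)-form (Remark 5.10, via [BSTW, Prop. 12.7]) is NOT vendored.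
[cite: YanZhu2024MainConjNonCM, Thm. 5.7 (2) (§5.2, arXiv:2412.20078v4 TeX l.1229–1241) with setting l.1189–1190, statement 5.6 l.1209–1215, `S_ord`/`κ` l.1199–1207; = arXiv v2 Thm. 4.12 (2)]
[cite: Howard2004HeegnerKolyvagin, §1 Thm. B and Thm. 3.3.7 (the currency `heegnerCharIdeal`, `𝐇 = Λκ`)] -/
def thm57_rankOne_charIdealTorsion_eq_heegnerCharIdeal_sq : Prop :=
  ∀ (_ : Thm57Hypotheses N W K p κ γ) (D : (W.baseChange K).LambdaAdicSelmerData κ γ)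
    (F : HeegnerFamily N W K κ jbar) (X : (W.baseChange K).SelmerDualData κ γ),
    (Module.Finite (IwasawaAlgebra p) D.S ∧ Module.finrank (IwasawaAlgebra p) D.S = 1) ∧
    (Module.Finite (IwasawaAlgebra p) X.X ∧ Module.finrank (IwasawaAlgebra p) X.X = 1) ∧
    ((∃ k : ℕ, ∀ g ∈ Module.charIdeal (IwasawaAlgebra p) (Submodule.torsion (IwasawaAlgebra p) X.X),
        (p : IwasawaAlgebra p) ^ k * g ∈ heegnerCharIdeal D F ^ 2) ∧
      (∃ k : ℕ, ∀ g ∈ heegnerCharIdeal D F ^ 2, (p : IwasawaAlgebra p) ^ k * g ∈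
        Module.charIdeal (IwasawaAlgebra p) (Submodule.torsion (IwasawaAlgebra p) X.X))) ∧
    ((∀ u : Module.End ℤ_[p] ((W.baseChange K).tateModule p), IsUnit u →
        u ∈ Set.range (galoisRepTate (W.baseChange K) p)) →
      Module.charIdeal (IwasawaAlgebra p) (Submodule.torsion (IwasawaAlgebra p) X.X) =
        heegnerCharIdeal D F ^ 2)

variable {N W K p κ γ jbar}

/-- Under full image of `ρ_E|_{G_K}`, Theorem 5.7 (2) gives the divisibility clause of the tree's
`Howard2004_thmB` shape: `char_Λ(𝒳_tors) ∣ char_Λ(S/𝐇)²` (and conversely `char_Λ(S/𝐇)² ∣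
char_Λ(𝒳_tors)`, the half a Kolyvagin-system argument alone does not give).
[cite: YanZhu2024MainConjNonCM, Thm. 5.7 (2), integral clause (arXiv v4 l.1236–1241)] -/
theorem charIdeal_torsion_dvd_and_dvd_of_thm57 (h : thm57_rankOne_charIdealTorsion_eq_heegnerCharIdeal_sq N W K p κ γ jbar)
    (hyp : Thm57Hypotheses N W K p κ γ) (D : (W.baseChange K).LambdaAdicSelmerData κ γ)
    (F : HeegnerFamily N W K κ jbar) (X : (W.baseChange K).SelmerDualData κ γ)
    (hsurj : ∀ u : Module.End ℤ_[p] ((W.baseChange K).tateModule p), IsUnit u →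
      u ∈ Set.range (galoisRepTate (W.baseChange K) p)) :
    Module.charIdeal (IwasawaAlgebra p) (Submodule.torsion (IwasawaAlgebra p) X.X) ∣
        heegnerCharIdeal D F ^ 2 ∧
      heegnerCharIdeal D F ^ 2 ∣
        Module.charIdeal (IwasawaAlgebra p) (Submodule.torsion (IwasawaAlgebra p) X.X) := by
  have hEq := (h hyp D F X).2.2.2 hsurj
  exact ⟨dvd_of_eq hEq, dvd_of_eq hEq.symm⟩

omit [NeZero N] in
/-- The hypotheses of Theorem 5.7 make `p` odd: `p ≠ 2`. [cite: YanZhu2024MainConjNonCM, §5.2 setting ("p > 2")] -/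
theorem Thm57Hypotheses.p_ne_two (hyp : Thm57Hypotheses N W K p κ γ) : p ≠ 2 := by
  have := hyp.three_le; omega

end HeegnerPoint

end Literature.NumberTheory.EllipticCurves.YanZhu2026

end
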